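import Mathlib
import Summits.ResolutionOfSingularities.ResolutionOfSingularities.Theorems.WeightedInvariantLocalWeightedDropNCBranchPrimesPresented

/-!
# `LocalWeightedDrop`, TOT2-LINE regime (P), piece (P3) brick B1 — FINITENESS OF THE TOP-LOCUS PRIMES WITH THE SYMBOLIC POWER:
# `{P prime ≠ 𝔪 | b ∈ P^(d)}` is finite for squarefree `b` (`d ≥ 2`)

Crux item stmt-ResolutionOfSingularities-8899 `WeightedInvariant.LocalWeightedDrop` (route `ResolutionOfSingularities/WeightedInvariant`), ENGINE
skeleton v35 (2e806da509994632), registered stub `stub_conflictBudget` (P3); brick **B1** of res-L1-w43-stub-2's CONFLICT-BUDGET DESIGN v1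
(f98794604b636b60, §1 (D1): «T := {P prime of R₃ | P ≠ 𝔪, F ∈ P^(d)} (symbolic power: ∃ s ∉ P, s·F ∈ P^d) is FINITE … NOTE the symbolic power:
stub-1's index set uses F ∈ P^d (ordinary), which misses singular branches with P^(d) ≠ P^d»), plan-1 RE-DEAL 2026-08-27T19:29:55Z (second hand =
this seat).  [OURS · L1 W4.3 · chain w43 · seat res-L1-w43-stub-1 gen 6; def-free; the chain argument of `…NCBranchPrimesFinite` with the first step
redone for the symbolic power; nothing here is a statement of any manuscript; AI-produced, gate-checked, weaker than expert review.]

* `mem_of_mul_mem_pow`, `pderiv_mem_of_mul_mem_pow` — `s ∉ P`, `s·b ∈ P^d` (`d ≥ 2`) ⇒ `b ∈ P` and `∂ᵢ b ∈ P` (`∂(sb) = s∂b + b∂s ∈ P^{d−1}`);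
* `mem_minimalPrimes_of_mem_of_pderiv_mem` — the chain argument of `NCBranchPrimes.mem_minimalPrimes` from `b ∈ P`, `∂ᵢb ∈ P` alone;
* **`finite_primes_of_mul_mem_pow`** — `Set.Finite {P | P.IsPrime ∧ P ≠ 𝔪 ∧ ∃ s ∉ P, s * b ∈ P ^ d}` for squarefree `b`, `2 ≤ d` (`k` perfect,
  char `p`); `finite_primes_of_monicGerm_mul_mem_pow`, **`finite_primes_symb_of_presContext`** (under the context binder of the budget laws).
The set with the ordinary power (`…NCBranchPrimesFinite`) is the subset `s = 1`.
-/

set_option linter.dupNamespace false -- mandated namespace of this single-conjunct summit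

noncomputable section

namespace Summit.ResolutionOfSingularities.ResolutionOfSingularities.Theorems

namespace NCBranchPrimes

open MvPowerSeries PolyDescent MonicDescent WildMonic NCPoly TameFourTupleDrop Literature.AlgebraicGeometry.Resolution

variable {k : Type} [Field k]

/-! ## From the symbolic power to `b, ∂ᵢb ∈ P` -/

/-- `s ∉ P`, `s·b ∈ P^d`, `d ≠ 0` ⇒ `b ∈ P`. -/
theorem mem_of_mul_mem_pow {σ : Type} {P : Ideal (MvPowerSeries σ k)} (hP : P.IsPrime) {s b : MvPowerSeries σ k} {d : ℕ} (hd : d ≠ 0)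
    (hs : s ∉ P) (hsb : s * b ∈ P ^ d) : b ∈ P :=
  (hP.mem_or_mem (Ideal.pow_le_self hd hsb)).resolve_left hs

/-- `s ∉ P`, `s·b ∈ P^d`, `d ≥ 2` ⇒ `∂ᵢ b ∈ P` (`∂ᵢ(sb) = s ∂ᵢb + b ∂ᵢs ∈ P^{d-1} ⊆ P` and `b ∂ᵢ s ∈ P`). -/
theorem pderiv_mem_of_mul_mem_pow {σ : Type} {P : Ideal (MvPowerSeries σ k)} (hP : P.IsPrime) {s b : MvPowerSeries σ k} {d : ℕ}
    (hd : 2 ≤ d) (hs : s ∉ P) (hsb : s * b ∈ P ^ d) (i : σ) : MvPowerSeries.pderiv i b ∈ P := by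
  have hb : b ∈ P := mem_of_mul_mem_pow hP (by omega) hs hsb
  have h1 : MvPowerSeries.pderiv i (s * b) ∈ P := pderiv_mem_of_mem_pow hd hsb i
  rw [Derivation.leibniz, smul_eq_mul, smul_eq_mul] at h1
  -- `h1 : s * ∂b + b * ∂s ∈ P`
  have h2 : s * MvPowerSeries.pderiv i b ∈ P := by
    have h3 := Ideal.sub_mem P h1 (Ideal.mul_mem_right (MvPowerSeries.pderiv i s) P hb)
    rwa [add_sub_cancel_right] at h3
  exact (hP.mem_or_mem h2).resolve_left hs

/-! ## The chain argument from `b ∈ P`, `∂ᵢ b ∈ P` -/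

/-- MINIMALITY from membership alone: for squarefree `b`, a non-maximal prime `P` containing `b` and its three partials is a minimal prime of
`J = (b, ∂₀b, ∂₁b, ∂₂b)` (the chain argument of `NCBranchPrimes.mem_minimalPrimes`). -/
theorem mem_minimalPrimes_of_mem_of_pderiv_mem (p : ℕ) [Fact p.Prime] [CharP k p] [PerfectRing k p] {b : MvPowerSeries (Fin 3) k}
    (hb : Squarefree b) {P : Ideal (MvPowerSeries (Fin 3) k)} (hP : P.IsPrime) (hPm : P ≠ IsLocalRing.maximalIdeal (MvPowerSeries (Fin 3) k))
    (hbP : b ∈ P) (hdP : ∀ i, MvPowerSeries.pderiv i b ∈ P) :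
    P ∈ (Ideal.span (insert b (Set.range fun i => MvPowerSeries.pderiv i b))).minimalPrimes := by
  classical
  haveI := TameFourTupleDrop.uniqueFactorizationMonoid_mvPowerSeries (k := k) 3
  have hb0 : b ≠ 0 := hb.ne_zero
  have hJP : Ideal.span (insert b (Set.range fun i => MvPowerSeries.pderiv i b)) ≤ P := by
    rw [Ideal.span_le]
    rintro x (rfl | ⟨i, rfl⟩)
    · exact hbP
    · exact hdP i
  refine ⟨⟨hP, hJP⟩, ?_⟩
  rintro Q ⟨hQ, hJQ⟩ hQP
  by_contra hPQ
  have hQP' : Q < P := lt_of_le_of_ne hQP (fun h => hPQ h.symm.le)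
  have hbQ : b ∈ Q := hJQ (Ideal.subset_span (Set.mem_insert _ _))
  have hQ0 : Q ≠ ⊥ := fun h => hb0 (by rw [h, Ideal.mem_bot] at hbQ; exact hbQ)
  obtain ⟨g, hgQ, hg⟩ := hQ.exists_mem_prime_of_ne_bot hQ0
  have hgQ' : Ideal.span {g} ≤ Q := (Ideal.span_singleton_le_iff_mem _).mpr hgQ
  by_cases hgQe : Ideal.span {g} = Q
  · rw [← hgQe] at hJQ
    refine not_prime_dvd_all p hb hg ?_ ?_
    · exact Ideal.mem_span_singleton.mp (hJQ (Ideal.subset_span (Set.mem_insert _ _)))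
    · intro i
      exact Ideal.mem_span_singleton.mp (hJQ (Ideal.subset_span (Set.mem_insert_of_mem _ ⟨i, rfl⟩)))
  · have h1 : (⊥ : Ideal (MvPowerSeries (Fin 3) k)) < Ideal.span {g} := by
      rw [bot_lt_iff_ne_bot, Ne, Ideal.span_singleton_eq_bot]
      exact hg.ne_zero
    have h2 : Ideal.span {g} < Q := lt_of_le_of_ne hgQ' hgQe
    have h4 : P < IsLocalRing.maximalIdeal _ := lt_of_le_of_ne (IsLocalRing.le_maximalIdeal hP.ne_top) hPm
    haveI : (Ideal.span {g}).IsPrime := (Ideal.span_singleton_prime hg.ne_zero).mpr hg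
    haveI := hQ
    haveI := hP
    exact no_chain_four h1 h2 hQP' h4

/-! ## Finiteness with the symbolic power -/

/-- **B1 — FINITENESS OF THE TOP-LOCUS PRIMES (SYMBOLIC POWER).**  `k` perfect of characteristic `p`, `b ∈ k⟦X₀,X₁,X₂⟧` squarefree, `d ≥ 2`:
the non-maximal primes `P` with `b ∈ P^(d)` — i.e. `s·b ∈ P^d` for some `s ∉ P` — are finitely many. -/
theorem finite_primes_of_mul_mem_pow (p : ℕ) [Fact p.Prime] [CharP k p] [PerfectRing k p] {b : MvPowerSeries (Fin 3) k} (hb : Squarefree b)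
    {d : ℕ} (hd : 2 ≤ d) :
    Set.Finite {P : Ideal (MvPowerSeries (Fin 3) k) | P.IsPrime ∧ P ≠ IsLocalRing.maximalIdeal (MvPowerSeries (Fin 3) k) ∧
      ∃ s : MvPowerSeries (Fin 3) k, s ∉ P ∧ s * b ∈ P ^ d} := by
  haveI : IsNoetherianRing (MvPowerSeries (Fin 3) k) := isNoetherianRing_mvPowerSeries k (Fin 3)
  refine (Ideal.finite_minimalPrimes_of_isNoetherianRing (MvPowerSeries (Fin 3) k)
    (Ideal.span (insert b (Set.range fun i => MvPowerSeries.pderiv i b)))).subset ?_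
  rintro P ⟨hP, hPm, s, hs, hsb⟩
  exact mem_minimalPrimes_of_mem_of_pderiv_mem p hb hP hPm (mem_of_mul_mem_pow hP (by omega) hs hsb)
    (pderiv_mem_of_mul_mem_pow hP hd hs hsb)

/-- B1 for the MONIC GERM of a label with squarefree germ. -/
theorem finite_primes_of_monicGerm_mul_mem_pow (p : ℕ) [Fact p.Prime] [CharP k p] [PerfectRing k p] {d : ℕ} (hd : 2 ≤ d)
    (A : Fin d → MvPowerSeries (Fin 2) k) (hsq : Squarefree (NCPoly.monicGerm d A)) :
    Set.Finite {P : Ideal (MvPowerSeries (Fin 3) k) | P.IsPrime ∧ P ≠ IsLocalRing.maximalIdeal (MvPowerSeries (Fin 3) k) ∧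
      ∃ s : MvPowerSeries (Fin 3) k, s ∉ P ∧ s * NCPoly.monicGerm d A ∈ P ^ d} :=
  finite_primes_of_mul_mem_pow p hsq hd

/-- **B1 UNDER THE CONTEXT of the budget laws** (`∃ b δ Θ, Admissible b δ ∧ 2 ≤ δ.o ∧ δ.c = d ∧ δ.PresBy d A N Θ`). -/
theorem finite_primes_symb_of_presContext (p : ℕ) [Fact p.Prime] [CharP k p] [PerfectRing k p] {d : ℕ} {A : Fin d → MvPowerSeries (Fin 2) k}
    {N : Finset (Fin 2)}
    (hctx : ∃ (b : MvPowerSeries (Fin (2 + 1)) k) (δ : Decoration k 2) (Θ : Fin (2 + 1) → MvPowerSeries (Fin (2 + 1)) k),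
      Admissible b δ ∧ 2 ≤ δ.o ∧ δ.c = d ∧ δ.PresBy d A N Θ) :
    Set.Finite {P : Ideal (MvPowerSeries (Fin 3) k) | P.IsPrime ∧ P ≠ IsLocalRing.maximalIdeal (MvPowerSeries (Fin 3) k) ∧
      ∃ s : MvPowerSeries (Fin 3) k, s ∉ P ∧ s * NCPoly.monicGerm d A ∈ P ^ d} :=
  finite_primes_of_mul_mem_pow p (squarefree_monicGerm_of_presContext hctx) (two_le_of_presContext hctx)

/-- The ordinary-power index set is contained in the symbolic one (`s = 1`). -/
theorem setOf_mem_pow_subset_setOf_mul_mem_pow {b : MvPowerSeries (Fin 3) k} {d : ℕ} :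
    {P : Ideal (MvPowerSeries (Fin 3) k) | P.IsPrime ∧ P ≠ IsLocalRing.maximalIdeal (MvPowerSeries (Fin 3) k) ∧ b ∈ P ^ d} ⊆
      {P : Ideal (MvPowerSeries (Fin 3) k) | P.IsPrime ∧ P ≠ IsLocalRing.maximalIdeal (MvPowerSeries (Fin 3) k) ∧
        ∃ s : MvPowerSeries (Fin 3) k, s ∉ P ∧ s * b ∈ P ^ d} := by
  rintro P ⟨hP, hPm, hb⟩
  exact ⟨hP, hPm, 1, fun h1 => hP.ne_top ((Ideal.eq_top_iff_one P).mpr h1), by rwa [one_mul]⟩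

end NCBranchPrimes

end Summit.ResolutionOfSingularities.ResolutionOfSingularities.Theorems

end
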